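import Summits.HodgeConjecture.HodgeConjecture.Theses.SignSymmetricPowers
import Literature.AlgebraicGeometry.HodgeTheory.HypersurfaceEigenHodgeNumbersJacobian
import Literature.AlgebraicGeometry.HodgeTheory.CompleteIntersectionHilbertFunctionSign
import Literature.AlgebraicGeometry.HodgeTheory.CyclicCoverEigenHodgeNumbers
import Literature.AlgebraicGeometry.Motives.GeneralNonsingularForms

/-!
# K1-B eigen-Hodge numbers of the sign involution (route `SignSymmetricPowers`, item stmt-HodgeConjecture-19716)

Discharges the registered stub `stub_signDeckHodge` of the K1-B line `andre-zariski` v6 (skeleton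
`321786b0b42d6049`) of crux `VeryGeneralSignCommutatorsInHg` of route
`route-HodgeConjecture-SignSymmetricPowers`; landed `--supports stmt-HodgeConjecture-19716` (it does not
close the item). Sorry-free.

## Statement

`stub_signDeckHodge` (registered signature verbatim, with the line's `let`-prefix `pmul2`, `fac`, `shn`):
ASSUMING the named fact `voisin2003_finrank_eigenspace_inf_hodgePiece_of_diagonalStabilizer` (Voisin II,
Cor. 6.12 read equivariantly for a diagonal symmetry: the `μ`-eigenspace of `g_a^*` on `H^{n−q,q}(X_F)` has
the dimension of the `μ(∏ aᵢ)⁻¹`-eigenspace of `P ↦ P(a • x)` on the Jacobian ring `R_F` in degree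
`(q+1)d − (n+2)`, plus the hyperplane class), for every smooth quinary form `f` of even degree `d ≥ 4` all of
whose monomials have `e₀ + e₁` even, the `(−1)^j`-eigenspace of the involution `ι = diag(−1,−1,1,1,1)` on
`H^{3−q,q}(X_f)` has dimension `shn d j q` — the number of exponent vectors `β ∈ [0, d−2]⁵` with
`|β| = (q+1)d − 5` and `β₀ + β₁ ≡ j (mod 2)`, computed by the line as a coefficient of the product
`T·T·F·F·F` of parity-graded truncated geometric series (`pmul2` = multiplication in `ℕ[s]/(s²−1)[t]`).

## Proof

(1) The fact, at `n = 3`, `a = ι`, `μ = (−1)^j`: `∏ ιᵢ = 1`, and `2q = 3` is impossible, so the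
eigen-Hodge number is the `(−1)^j`-refined Hilbert function of `R_f = S/J_f` in degree `t = (q+1)d − 5`
(or `0` below degree `5`). (2) `f` is nonsingular, so by Euler's identity the partials `∂ᵢf` have no common
non-trivial zero and `R_f` is Artinian (`exists_X_pow_mem_jacobianIdeal_of_forall_eval_pderiv`); the
partials are `ι`-eigenforms, so the tree's sign-refined Macaulay theorem
`hilbertSign_jacobianIdeal_eq_card` (file `CompleteIntersectionHilbertFunctionSign`) gives the refined
Hilbert function as the box count `#{β : |β| = t, βᵢ ≤ d−2, ι^β = (−1)^j}`, `ι^β = (−1)^{β₀+β₁}`.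
(3) Pure combinatorics (`pm_getD`, `pm_getD_eq_card`, `fold5_getD_eq_card`, `card_box_parity_eq`): the
Cauchy product `pmul2` multiplies parity-graded counting series, each factor `fac d odd` counts `[0, d−2]`
by degree (split by parity iff `odd`), so entry `t` of `T·T·F·F·F` is (`#even`, `#odd`) of the box, and
the box of nested pairs is in bijection with the exponent vectors.

## References

* C. Voisin, *Hodge Theory and Complex Algebraic Geometry II* (2003), §6.1.3 Thm. 6.10 / Cor. 6.12,
  §6.2.2 — the named fact (binder `hV`) and the Jacobian ring. [cite: VoisinHodgeII2003]
* J. Carlson, S. Müller-Stach, C. Peters, *Period Mappings and Period Domains* (2nd ed. 2017), §7.4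
  Thm. 7.4.1 (Macaulay) — through `hilbertSign_jacobianIdeal_eq_card`. [cite: CarlsonMullerStachPeters2017]
-/

noncomputable section

open Finset MvPolynomial
open Literature.RingTheory.MvPolynomial Literature.AlgebraicGeometry.Motives Literature.AlgebraicGeometry.HodgeTheory

namespace Summit.HodgeConjecture.HodgeConjecture.Theorems.SignSymmetricPowersSignDeckHodge

/-! ### §1 Combinatorics of the line's generating function `shn` -/

/-- **Fibrewise count on a product**: the pairs `(x, y) ∈ S × T` with `dS x + dT y = k`, `P x` and `Q y`
are counted by the Cauchy sum `Σ_{i ≤ k} #{x : dS x = i, P x} · #{y : dT y = k − i, Q y}`. [folklore] -/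
theorem card_filter_product_eq_sum {X Y : Type*} (S : Finset X) (T : Finset Y) (dS : X → ℕ)
    (dT : Y → ℕ) (P : X → Prop) (Q : Y → Prop) [DecidablePred P] [DecidablePred Q] (k : ℕ) :
    ((S ×ˢ T).filter fun z => dS z.1 + dT z.2 = k ∧ P z.1 ∧ Q z.2).card =
      ∑ i ∈ range (k + 1),
        (S.filter fun x => dS x = i ∧ P x).card * (T.filter fun y => dT y = k - i ∧ Q y).card := by
  rw [card_eq_sum_card_fiberwise (f := fun z => dS z.1) (t := range (k + 1)) fun z hz => by
    simp only [coe_filter, Set.mem_setOf_eq] at hz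
    simp only [mem_coe, mem_range]
    omega]
  refine sum_congr rfl fun i hi => ?_
  rw [mem_range] at hi
  rw [filter_filter, ← card_product, ← filter_product]
  congr 1
  ext z
  simp only [mem_filter, mem_product]
  constructor
  · rintro ⟨⟨hzS, hzT⟩, ⟨hk, hP, hQ⟩, hi'⟩
    exact ⟨⟨hzS, hzT⟩, ⟨hi', hP⟩, by omega, hQ⟩
  · rintro ⟨⟨hzS, hzT⟩, ⟨hi', hP⟩, hk, hQ⟩
    exact ⟨⟨hzS, hzT⟩, ⟨by omega, hP, hQ⟩, hi'⟩

/-- Entries of the route's factor list `fac d odd`: entry `k < d − 1` is `(1, 0)` (resp. `(0, 1)` when the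
factor tracks parity and `k` is odd), i.e. it counts `{x ∈ [0, d−2] : x = k}` split by the parity
predicate. [folklore] -/
theorem fac_getD (d : ℕ) (p : Bool) (E : ℕ → Prop) [DecidablePred E] (hE : ∀ x, E x ↔ (p = true → Even x))
    (k : ℕ) :
    ((List.range (d - 1)).map fun k => if p ∧ ¬ Even k then ((0 : ℕ), (1 : ℕ)) else (1, 0)).getD k (0, 0) =
      (((range (d - 1)).filter fun x => x = k ∧ E x).card,
       ((range (d - 1)).filter fun x => x = k ∧ ¬ E x).card) := by
  have hfilter : ∀ (C : ℕ → Prop) [DecidablePred C],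
      ((range (d - 1)).filter fun x => x = k ∧ C x).card = if k < d - 1 ∧ C k then 1 else 0 := by
    intro C _
    split_ifs with h
    · rw [card_eq_one]
      refine ⟨k, ?_⟩
      ext x
      simp only [mem_filter, mem_range, mem_singleton]
      constructor
      · rintro ⟨-, rfl, -⟩; rfl
      · rintro rfl; exact ⟨h.1, rfl, h.2⟩
    · rw [card_eq_zero, filter_eq_empty_iff]
      rintro x hx ⟨rfl, hC⟩
      exact h ⟨mem_range.1 hx, hC⟩
  rw [hfilter, hfilter, List.getD_eq_getElem?_getD, List.getElem?_map]
  by_cases hk : k < d - 1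
  · rw [List.getElem?_range hk]
    cases p <;> by_cases he : Even k <;> simp [hk, hE, he]
  · rw [List.getElem?_eq_none (by rw [List.length_range]; omega)]
    simp only [Option.map_none, Option.getD_none, hk, false_and, if_false]

section PMul

variable (pm : List (ℕ × ℕ) → List (ℕ × ℕ) → List (ℕ × ℕ))
  (hpm : ∀ a b, pm a b = (List.range (a.length + b.length - 1)).map fun k =>
    (((List.range (k + 1)).map fun i =>
        (a.getD i (0, 0)).1 * (b.getD (k - i) (0, 0)).1 + (a.getD i (0, 0)).2 * (b.getD (k - i) (0, 0)).2).sum,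
     ((List.range (k + 1)).map fun i =>
        (a.getD i (0, 0)).1 * (b.getD (k - i) (0, 0)).2 + (a.getD i (0, 0)).2 * (b.getD (k - i) (0, 0)).1).sum))
include hpm

/-- **Coefficients of the parity-graded Cauchy product** (the route's `pmul2`, written out): entry `k` of
`pmul2 a b` is `(Σ_{i ≤ k} (a⁺ᵢ b⁺_{k−i} + a⁻ᵢ b⁻_{k−i}), Σ_{i ≤ k} (a⁺ᵢ b⁻_{k−i} + a⁻ᵢ b⁺_{k−i}))` for every `k`
— multiplication in `ℕ[s]/(s² − 1)[t]`. [folklore] -/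
theorem pm_getD (a b : List (ℕ × ℕ)) (k : ℕ) :
    (pm a b).getD k (0, 0) =
      (∑ i ∈ range (k + 1),
          ((a.getD i (0, 0)).1 * (b.getD (k - i) (0, 0)).1 + (a.getD i (0, 0)).2 * (b.getD (k - i) (0, 0)).2),
       ∑ i ∈ range (k + 1),
          ((a.getD i (0, 0)).1 * (b.getD (k - i) (0, 0)).2 + (a.getD i (0, 0)).2 * (b.getD (k - i) (0, 0)).1)) := by
  have hsum : ∀ (g : ℕ → ℕ) (n : ℕ), ((List.range n).map g).sum = ∑ i ∈ range n, g i := by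
    intro g n
    induction n with
    | zero => simp
    | succ n ih => rw [List.range_succ, List.map_append, List.sum_append, ih, Finset.sum_range_succ]; simp
  rw [hpm, List.getD_eq_getElem?_getD, List.getElem?_map]
  by_cases h : k < a.length + b.length - 1
  · rw [List.getElem?_range h]
    simp only [Option.map_some, Option.getD_some, hsum]
  · rw [List.getElem?_eq_none (by rw [List.length_range]; omega)]
    simp only [Option.map_none, Option.getD_none]
    have hz : ∀ i ∈ range (k + 1), a[i]?.getD (0, 0) = (0, 0) ∨ b[k - i]?.getD (0, 0) = (0, 0) := by
      intro i hi
      rw [mem_range] at hi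
      by_cases hia : i < a.length
      · right; rw [List.getElem?_eq_none (by omega), Option.getD_none]
      · left; rw [List.getElem?_eq_none (by omega), Option.getD_none]
    simp only [Prod.mk.injEq]
    refine ⟨(sum_eq_zero fun i hi => ?_).symm, (sum_eq_zero fun i hi => ?_).symm⟩ <;>
      rcases hz i hi with h0 | h0 <;> simp [h0]

/-- **The Cauchy product multiplies counting series**: if `a` counts `S` by degree `dS` split by the
parity predicate `ES`, and `b` counts `T` likewise, then `pmul2 a b` counts `S × T` by total degree split
by the product parity. [folklore] -/
theorem pm_getD_eq_card {X Y : Type*} [DecidableEq X] [DecidableEq Y] {S : Finset X} {T : Finset Y} {dS : X → ℕ} {dT : Y → ℕ}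
    {ES : X → Prop} {ET : Y → Prop} [DecidablePred ES] [DecidablePred ET] {a b : List (ℕ × ℕ)}
    (ha : ∀ k, a.getD k (0, 0) =
      ((S.filter fun x => dS x = k ∧ ES x).card, (S.filter fun x => dS x = k ∧ ¬ ES x).card))
    (hb : ∀ k, b.getD k (0, 0) =
      ((T.filter fun y => dT y = k ∧ ET y).card, (T.filter fun y => dT y = k ∧ ¬ ET y).card))
    {dU : X × Y → ℕ} {EU : X × Y → Prop} [DecidablePred EU] (hdU : ∀ z, dU z = dS z.1 + dT z.2)
    (hEU : ∀ z, EU z ↔ (ES z.1 ↔ ET z.2)) (k : ℕ) :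
    (pm a b).getD k (0, 0) =
      (((S ×ˢ T).filter fun z => dU z = k ∧ EU z).card,
       ((S ×ˢ T).filter fun z => dU z = k ∧ ¬ EU z).card) := by
  rw [pm_getD pm hpm]
  simp only [ha, hb]
  have h1 : ((S ×ˢ T).filter fun z => dU z = k ∧ EU z) =
      (S ×ˢ T).filter fun z => (dS z.1 + dT z.2 = k ∧ ES z.1 ∧ ET z.2) ∨
        (dS z.1 + dT z.2 = k ∧ ¬ ES z.1 ∧ ¬ ET z.2) :=
    filter_congr fun z _ => by rw [hdU, hEU]; tauto
  have h2 : ((S ×ˢ T).filter fun z => dU z = k ∧ ¬ EU z) =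
      (S ×ˢ T).filter fun z => (dS z.1 + dT z.2 = k ∧ ES z.1 ∧ ¬ ET z.2) ∨
        (dS z.1 + dT z.2 = k ∧ ¬ ES z.1 ∧ ET z.2) :=
    filter_congr fun z _ => by rw [hdU, hEU]; tauto
  rw [h1, h2, filter_or, filter_or,
    card_union_of_disjoint (disjoint_filter.2 fun z _ h h' => h'.2.1 h.2.1),
    card_union_of_disjoint (disjoint_filter.2 fun z _ h h' => h'.2.1 h.2.1),
    card_filter_product_eq_sum S T dS dT (fun x => ES x) (fun y => ET y) k,
    card_filter_product_eq_sum S T dS dT (fun x => ¬ ES x) (fun y => ¬ ET y) k,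
    card_filter_product_eq_sum S T dS dT (fun x => ES x) (fun y => ¬ ET y) k,
    card_filter_product_eq_sum S T dS dT (fun x => ¬ ES x) (fun y => ET y) k,
    ← sum_add_distrib, ← sum_add_distrib]

/-- **The five-fold product** `T·T·F·F·F` of the route (`T = fac d true`, `F = fac d false`) counts
`[0, d−2]⁵` by total degree, split by the parity of the sum of the first two coordinates. [folklore] -/
theorem fold5_getD_eq_card (fc : ℕ → Bool → List (ℕ × ℕ))
    (hfc : ∀ d p, fc d p = (List.range (d - 1)).map fun k => if p ∧ ¬ Even k then (0, 1) else (1, 0))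
    (d k : ℕ) :
    (pm (pm (pm (pm (fc d true) (fc d true)) (fc d false)) (fc d false)) (fc d false)).getD k (0, 0) =
      ((((((range (d - 1) ×ˢ range (d - 1)) ×ˢ range (d - 1)) ×ˢ range (d - 1)) ×ˢ range (d - 1)).filter
          fun z => z.1.1.1.1 + z.1.1.1.2 + z.1.1.2 + z.1.2 + z.2 = k ∧ Even (z.1.1.1.1 + z.1.1.1.2)).card,
       (((((range (d - 1) ×ˢ range (d - 1)) ×ˢ range (d - 1)) ×ˢ range (d - 1)) ×ˢ range (d - 1)).filter
          fun z => z.1.1.1.1 + z.1.1.1.2 + z.1.1.2 + z.1.2 + z.2 = k ∧ ¬ Even (z.1.1.1.1 + z.1.1.1.2)).card) := by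
  have hT : ∀ k, (fc d true).getD k (0, 0) =
      (((range (d - 1)).filter fun x => x = k ∧ Even x).card,
       ((range (d - 1)).filter fun x => x = k ∧ ¬ Even x).card) := fun k => by
    rw [hfc]; exact fac_getD d true (fun x => Even x) (fun x => by simp) k
  have hF : ∀ k, (fc d false).getD k (0, 0) =
      (((range (d - 1)).filter fun x => x = k ∧ True).card,
       ((range (d - 1)).filter fun x => x = k ∧ ¬ True).card) := fun k => by
    rw [hfc]; exact fac_getD d false (fun _ => True) (fun x => by simp) k
  have h2 := pm_getD_eq_card pm hpm (hT) (hT) (dU := fun (z : ℕ × ℕ) => z.1 + z.2)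
    (EU := fun z => Even (z.1 + z.2)) (fun z => rfl) (fun z => by rw [Nat.even_add])
  have h3 := pm_getD_eq_card pm hpm h2 hF (dU := fun (z : (ℕ × ℕ) × ℕ) => z.1.1 + z.1.2 + z.2)
    (EU := fun z => Even (z.1.1 + z.1.2)) (fun z => rfl) (fun z => by simp)
  have h4 := pm_getD_eq_card pm hpm h3 hF (dU := fun (z : ((ℕ × ℕ) × ℕ) × ℕ) => z.1.1.1 + z.1.1.2 + z.1.2 + z.2)
    (EU := fun z => Even (z.1.1.1 + z.1.1.2)) (fun z => rfl) (fun z => by simp)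
  exact pm_getD_eq_card pm hpm h4 hF (fun z => rfl) (fun z => by simp) k

end PMul

/-- **Transfer to exponent vectors**: the parity-refined box count on `Fin 5 →₀ ℕ` (the shape produced by
the sign-refined Hilbert function) equals the nested-pair count. [folklore] -/
theorem card_box_parity_eq (d t : ℕ) (hd : 2 ≤ d) (E : ℕ → Prop) [DecidablePred E] :
    (((univ : Finset (Fin 5)).finsuppAntidiag t).filter
        fun β : Fin 5 →₀ ℕ => (∀ i, β i ≤ d - 2) ∧ E (β 0 + β 1)).card =
      (((((range (d - 1) ×ˢ range (d - 1)) ×ˢ range (d - 1)) ×ˢ range (d - 1)) ×ˢ range (d - 1)).filter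
          fun z => z.1.1.1.1 + z.1.1.1.2 + z.1.1.2 + z.1.2 + z.2 = t ∧ E (z.1.1.1.1 + z.1.1.1.2)).card := by
  refine card_nbij' (fun β => ((((β 0, β 1), β 2), β 3), β 4))
    (fun z => Finsupp.equivFunOnFinite.symm ![z.1.1.1.1, z.1.1.1.2, z.1.1.2, z.1.2, z.2])
    (fun β hβ => ?_) (fun z hz => ?_) (fun β _ => ?_) (fun z _ => ?_)
  · simp only [mem_coe, mem_filter, mem_finsuppAntidiag, Fin.sum_univ_five] at hβ ⊢
    simp only [mem_product, mem_range]
    obtain ⟨⟨hsum, -⟩, hle, hE⟩ := hβ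
    have := hle 0; have := hle 1; have := hle 2; have := hle 3; have := hle 4
    refine ⟨⟨⟨⟨⟨by omega, by omega⟩, by omega⟩, by omega⟩, by omega⟩, hsum, hE⟩
  · simp only [mem_coe, mem_filter, mem_product, mem_range] at hz
    simp only [mem_coe, mem_filter, mem_finsuppAntidiag, Fin.sum_univ_five, Finsupp.coe_equivFunOnFinite_symm,
      subset_univ, and_true]
    simp only [Matrix.cons_val_zero, Matrix.cons_val_one, Matrix.head_cons, Matrix.cons_val_two,
      Matrix.tail_cons, Matrix.cons_val_three, Matrix.cons_val_four]
    refine ⟨by omega, fun i => ?_, hz.2.2⟩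
    fin_cases i <;> simp <;> omega
  · ext i
    fin_cases i <;> simp
  · simp


/-! ### §2 The Jacobian ring of a nonsingular form is Artinian -/

/-- **Euler**: a common zero of the partials of a form of positive degree is a zero of the form
(`d · f = Σ xⱼ ∂ⱼ f`). [cite: VoisinHodgeII2003, §6.2.2 before Def. 6.18 (held text chunk p0165)] -/
theorem eval_eq_zero_of_forall_eval_pderiv_eq_zero {N d : ℕ} {f : MvPolynomial (Fin N) ℂ}
    (hf : f.IsHomogeneous d) (hd : d ≠ 0) (x : Fin N → ℂ) (hx : ∀ j, eval x (pderiv j f) = 0) :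
    eval x f = 0 := by
  have h := congrArg (eval x) hf.sum_X_mul_pderiv
  rw [map_sum, map_nsmul, Finset.sum_eq_zero fun j _ ↦ by rw [map_mul, hx j, mul_zero],
    nsmul_eq_mul] at h
  rcases mul_eq_zero.1 h.symm with h1 | h1
  · exact absurd h1 (Nat.cast_ne_zero.2 hd)
  · exact h1

/-- **For a nonsingular form the Jacobian ring is Artinian**: some power of every variable lies in
`J_f = (∂₀f, …, ∂₄f)` (nonsingularity at the prime `ker ev_x` of a common zero `x ≠ 0` of the partials,
which is a zero of `f` by Euler, would put every `xᵢ` in it; then the Nullstellensatz lemma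
`exists_X_pow_mem_jacobianIdeal_of_forall_eval_pderiv`). [cite: VoisinHodgeII2003, §6.2.2 before Def. 6.18 (held text chunk p0165)] -/
theorem exists_X_pow_mem_jacobianIdeal {N d : ℕ} {f : MvPolynomial (Fin (N + 2)) ℂ}
    (hf : f.IsHomogeneous d) (hd : d ≠ 0) (hns : SmoothHypersurface.IsNonsingularForm ℂ f) :
    ∃ M, ∀ l, (X l : MvPolynomial (Fin (N + 2)) ℂ) ^ M ∈ UniversalHypersurface.jacobianIdeal (N := N + 1) f := by
  obtain ⟨M, -, hM⟩ := exists_X_pow_mem_jacobianIdeal_of_forall_eval_pderiv (N := N + 1) (f := f)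
    fun x hx ↦ by
      by_contra hx0
      obtain ⟨j, hj⟩ := hns.exists_eval_pderiv_ne_zero hx0
        (eval_eq_zero_of_forall_eval_pderiv_eq_zero hf hd x hx)
      exact hj (hx j)
  exact ⟨M, hM⟩

/-! ### §3 The stub -/

/-- The sign character of a monomial: `ι^β = (−1)^{β₀ + β₁}` for `ι = (−1,−1,1,1,1)`.
[cite: VoisinHodgeII2003, §6.1.3 (held text chunk p0159)] -/
theorem prod_signInvolutionVector_pow (β : Fin 5 →₀ ℕ) :
    ∏ i, ((signInvolutionVector i : ℂˣ) : ℂ) ^ β i = (-1) ^ (β 0 + β 1) := by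
  rw [Fin.prod_univ_five]
  simp only [signInvolutionVector, Fin.val_zero, Fin.val_one, Fin.val_two, Nat.zero_lt_two,
    Nat.one_lt_two, lt_self_iff_false, if_true, if_false, Units.val_neg, Units.val_one, one_pow, mul_one,
    show ¬ ((3 : Fin 5) : ℕ) < 2 by decide, show ¬ ((4 : Fin 5) : ℕ) < 2 by decide, pow_add]

/-- `ι^β = (−1)^j` (`j < 2`) iff `β₀ + β₁` has the parity of `j`. [cite: VoisinHodgeII2003, §6.1.3 (held text chunk p0159)] -/
theorem prod_signInvolutionVector_pow_eq_iff (β : Fin 5 →₀ ℕ) {j : ℕ} (hj : j < 2) :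
    ∏ i, ((signInvolutionVector i : ℂˣ) : ℂ) ^ β i = (-1) ^ j ↔ (j = 0 ↔ Even (β 0 + β 1)) := by
  rw [prod_signInvolutionVector_pow]
  rcases Nat.even_or_odd (β 0 + β 1) with h | h
  · rw [h.neg_one_pow]
    obtain rfl | rfl : j = 0 ∨ j = 1 := by omega
    · simp [h]
    · simp only [pow_one, one_ne_zero, h, iff_true]
      norm_num
  · rw [h.neg_one_pow]
    obtain rfl | rfl : j = 0 ∨ j = 1 := by omega
    · simp only [pow_zero, Nat.not_even_iff_odd.mpr h, iff_false, not_true_eq_false, iff_false]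
      norm_num
    · simp [Nat.not_even_iff_odd.mpr h]

/-- **`stub_signDeckHodge`** (K1-B line `andre-zariski` v6, registered signature verbatim): assuming the
equivariant Griffiths–Voisin residue theorem (the named fact, binder `hV`), the `(−1)^j`-eigenspace of
`ι = diag(−1,−1,1,1,1)` on `H^{3−q,q}` of a smooth `ι`-even quinary form of even degree `d ≥ 4` has
dimension `shn d j q`. [cite: VoisinHodgeII2003, §6.1.3 Cor. 6.12 (held text chunk p0161)]
[cite: CarlsonMullerStachPeters2017, §7.4 Thm. 7.4.1] -/
theorem stub_signDeckHodge :
    open Literature.AlgebraicGeometry.Motives Literature.AlgebraicGeometry.HodgeTheory Literature.AlgebraicGeometry.HodgeTheory.BettiUniverse CategoryTheory.Limits in let pmul2 : List (ℕ × ℕ) → List (ℕ × ℕ) → List (ℕ × ℕ) := fun a b => (List.range (a.length + b.length - 1)).map fun k => (((List.range (k + 1)).map fun i => (a.getD i (0, 0)).1 * (b.getD (k - i) (0, 0)).1 + (a.getD i (0, 0)).2 * (b.getD (k - i) (0, 0)).2).sum, ((List.range (k + 1)).map fun i => (a.getD i (0, 0)).1 * (b.getD (k - i) (0, 0)).2 +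 (a.getD i (0, 0)).2 * (b.getD (k - i) (0, 0)).1).sum); let fac : ℕ → Bool → List (ℕ × ℕ) := fun d odd => (List.range (d - 1)).map fun k => if odd ∧ ¬ Even k then (0, 1) else (1, 0); let shn : ℕ → ℕ → ℕ → ℕ := fun d j q => if (q + 1) * d < 5 then 0 else if j = 0 then (([fac d true, fac d false, fac d false, fac d false].foldl pmul2 (fac d true)).getD ((q + 1) * d - 5) (0, 0)).1 else (([fac d true, fac d false, fac d false, fac d false].foldl pmul2 (fac d true)).getD ((q + 1) * d - 5) (0, 0)).2; voisin2003_finrank_eigenspace_inf_hodgePiece_of_diagonalStabilizer → ∀ ⦃d : ℕ⦄, Even d → 4 ≤ d → ∀ f : MvPolynomial (Fin 5) ℂ, f.IsHomogeneous d → (∀ e : Fin 5 →₀ ℕ, ¬ Even (e 0 + e 1) → f.coeff e = 0) → SmoothHypersurface.IsNonsingularForm ℂ f → ∀ (hXF : IsSmoothProjective 3 (SmoothHypersurface.hypersurface f)) (ha : (fun i : Fin 5 => if (i : ℕ) < 2 then (-1 : ℂˣ) else 1) ∈ diagonalStabilizer f), ∀ j q : ℕ, j < 2 → q ≤ 3 →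 Module.finrank ℂ ↥(Module.End.eigenspace ((pull (diagonalAut f ha) 3).baseChange ℂ) ((-1 : ℂ) ^ j) ⊓ (hodge exists_isReal_hodgeModel_holds hXF 3).piece ((3 : ℤ) - q) q) = shn d j q := by
  intro pmul2 fac shn hV d hd h4 f hf hcoef hns hXF ha j q hj hq
  have hpm : ∀ a b, pmul2 a b = (List.range (a.length + b.length - 1)).map fun k =>
      (((List.range (k + 1)).map fun i =>
          (a.getD i (0, 0)).1 * (b.getD (k - i) (0, 0)).1 + (a.getD i (0, 0)).2 * (b.getD (k - i) (0, 0)).2).sum,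
       ((List.range (k + 1)).map fun i =>
          (a.getD i (0, 0)).1 * (b.getD (k - i) (0, 0)).2 + (a.getD i (0, 0)).2 * (b.getD (k - i) (0, 0)).1).sum) :=
    fun a b ↦ rfl
  have hfc : ∀ d p, fac d p = (List.range (d - 1)).map fun k => if p ∧ ¬ Even k then (0, 1) else (1, 0) :=
    fun d p ↦ rfl
  -- (1) the named fact at `n = 3`, `a = ι`, `μ = (−1)^j`
  have hmain := hV exists_isReal_hodgeModel_holds 3 d (by norm_num) f hf hns hXF _ ha ((-1 : ℂ) ^ j) q hq
  rw [show (3 : ℤ) - (q : ℤ) = ((3 : ℕ) : ℤ) - (q : ℤ) from rfl, hmain,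
    if_neg (show ¬ ((-1 : ℂ) ^ j = 1 ∧ 2 * q = 3) from fun h ↦ by omega), add_zero]
  change _ = if (q + 1) * d < 5 then 0 else if j = 0 then
      ((pmul2 (pmul2 (pmul2 (pmul2 (fac d true) (fac d true)) (fac d false)) (fac d false)) (fac d false)).getD
        ((q + 1) * d - 5) (0, 0)).1 else
      ((pmul2 (pmul2 (pmul2 (pmul2 (fac d true) (fac d true)) (fac d false)) (fac d false)) (fac d false)).getD
        ((q + 1) * d - 5) (0, 0)).2
  by_cases hlt : (q + 1) * d < 5
  · rw [if_pos (show (q + 1) * d < 3 + 2 from hlt), if_pos hlt]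
  rw [if_neg (show ¬ (q + 1) * d < 3 + 2 from hlt), if_neg hlt, show (q + 1) * d - (3 + 2) = (q + 1) * d - 5 from rfl]
  -- (2) the sign-refined Hilbert function of the Artinian Jacobian ring
  have hprod : ∏ i, (((fun i : Fin 5 => if (i : ℕ) < 2 then (-1 : ℂˣ) else 1) i : ℂˣ) : ℂ) = 1 :=
    prod_signInvolutionVector
  rw [hprod, inv_one, mul_one, inf_comm (Module.End.eigenspace _ _) (homogeneousSubmodule _ _ _),
    inf_comm (Module.End.eigenspace _ _) (idealDegree _ _)]
  obtain ⟨M, hXM⟩ := exists_X_pow_mem_jacobianIdeal hf (by omega) hns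
  have had : ∀ i, ((((fun i : Fin 5 => if (i : ℕ) < 2 then (-1 : ℂˣ) else 1) i : ℂˣ) : ℂ)) ^ d = 1 := by
    intro i
    dsimp only
    split_ifs
    · rw [Units.val_neg, Units.val_one, hd.neg_one_pow]
    · rw [Units.val_one, one_pow]
  have hc : (-1 : ℂ) ^ j = 1 ∨ (-1 : ℂ) ^ j = -1 := by
    obtain rfl | rfl : j = 0 ∨ j = 1 := by omega
    · exact Or.inl (pow_zero _)
    · exact Or.inr (pow_one _)
  rw [hilbertSign_jacobianIdeal_eq_card (n := 3) hf (by omega) (signUnits_mul_self 2) ha had hXM hc]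
  -- (3) combinatorics
  have hfilt : (((univ : Finset (Fin 5)).finsuppAntidiag ((q + 1) * d - 5)).filter
      fun β : Fin 5 →₀ ℕ ↦ (∀ i, β i ≤ d - 2) ∧
        (∏ i, (((fun i : Fin 5 => if (i : ℕ) < 2 then (-1 : ℂˣ) else 1) i : ℂˣ) : ℂ) ^ β i) = (-1) ^ j) =
      ((univ : Finset (Fin 5)).finsuppAntidiag ((q + 1) * d - 5)).filter
        fun β : Fin 5 →₀ ℕ ↦ (∀ i, β i ≤ d - 2) ∧ (j = 0 ↔ Even (β 0 + β 1)) :=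
    filter_congr fun β _ ↦ by rw [← signInvolutionVector_eq, prod_signInvolutionVector_pow_eq_iff β hj]
  rw [hfilt, card_box_parity_eq d _ (by omega) (fun m ↦ (j = 0 ↔ Even m)),
    fold5_getD_eq_card pmul2 hpm fac hfc d ((q + 1) * d - 5)]
  obtain rfl | rfl : j = 0 ∨ j = 1 := by omega
  · simp only [if_true, true_iff]
  · simp only [one_ne_zero, if_false, false_iff]

end Summit.HodgeConjecture.HodgeConjecture.Theorems.SignSymmetricPowersSignDeckHodge

end
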